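import Literature.AlgebraicGeometry.Frobenioids.ModelFrobenioidPhiBirat
import Literature.AlgebraicGeometry.Frobenioids.ArithmeticFrobenioidStandard
import Literature.AlgebraicGeometry.Frobenioids.ArithmeticDivisorsPrimes
import Literature.AlgebraicGeometry.Frobenioids.MotivatingExamplesSub
import HarnessLib

/-!
# Frobenioids I, Theorem 6.4 (i): every object of `C_{K/F}` is strictly rational (Def. 4.5 (ii)) — PROOF

Mochizuki, *The geometry of Frobenioids I: the general theory*, Kyushu J. Math. **62** (2008) 293–400,
proof of Theorem 6.4 (i), kurims text p. 115 l. 37–38: "Also, it is immediate from the definition of `B` that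
`C` is of [strictly] rational type"; Definition 4.5 (ii), p. 86. [cite: MochizukiFrdI2008, Thm. 6.4 (i) p.115]

PROOF-ONLY (seat abc-iut-L6-t10 gen 2, S3 sub-DAG holder — the "rational type" conjunct of row **T64i/L10**
`IsOfRationallyStandardType R` at THE parameters), over THE birationalization `PreFrobenioid.biratData` of the
constructed arithmetic model (`ModelFrobenioidPhiBirat.lean`: `Φ^birat(A_D) = Div_B(B(A_D))`) and for ANY
support predicate `Supp` satisfying the support axiom `hSupp` — "`𝔭 ∈ Supp(a)` iff some primary element of the
class `𝔭` is `≼ a`" (the shape of THE support of Def. 2.4 (i)(d) for `Φ(L) = ⊕ ℤ_{≥0} ⊕ ⊕ ℝ_{≥0}`; its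
verification for THE `Supp` rides with abc-iut-L1-d2's perf-factorial structure, T64i/L02). PROVED:
* `ArithDivisor.pos` / `neg` calculus stated inline (no definitions): every arithmetic divisor is the difference
  of its positive and negative parts, effective divisors with disjoint supports (`exists_pos_neg`);
* `arith_exists_rational_function_pos` — from abc-iut-L1-t1's data row T64i/L08
  (`Thm64i_L08_strictlyRational_data`, discharged by abc-iut-L1-t1): at every place `p` of `L` some `g ∈ L^×`
  has `div(g)` POSITIVE at `p` (at an archimedean place use `f` or `f⁻¹`);
* `isStrictlyRational_arith` — **every object of `C_{K/F}` is strictly rational** w.r.t. THE birationalization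
  and any `Supp` as above; `isRational_arith` — hence rational (Def. 4.5 (ii)).
No definitions; nothing here bears on [IUTchIII] or asserts anything about abc.
-/

noncomputable section

namespace Literature.AlgebraicGeometry.Frobenioids

open CategoryTheory Opposite Function NumberField

/-! ### Positive and negative parts of an arithmetic divisor -/

namespace EffArithDivisor

variable {L : Type} [Field L] [NumberField L]

/-- `max x 0`, as an element of `ℝ_{≥0}`, is nonzero iff `x > 0`. [cite: MochizukiFrdI2008, Ex. 6.3 p.113] -/
private theorem mk_max_ne_zero_iff (x : ℝ) : (⟨max x 0, le_max_right _ _⟩ : NNReal) ≠ 0 ↔ 0 < x := by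
  constructor
  · intro h
    by_contra h'
    exact h (NNReal.eq (by change max x 0 = ((0 : NNReal) : ℝ); rw [NNReal.coe_zero, max_eq_right (not_lt.mp h')]))
  · intro h h'
    have := congrArg (fun r : NNReal => (r : ℝ)) h'
    change max x 0 = ((0 : NNReal) : ℝ) at this
    rw [NNReal.coe_zero, max_eq_left h.le] at this
    exact h.ne' this

/-- Every arithmetic divisor `d` is `a − b` with `a, b` EFFECTIVE, `a` supported exactly where `d > 0` and `b`
exactly where `d < 0` (coordinatewise positive / negative parts). [cite: MochizukiFrdI2008, Ex. 6.3 p.113] -/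
theorem exists_pos_neg (d : ArithDivisor L) :
    ∃ a b : EffArithDivisor L, toArithDivisor L a - toArithDivisor L b = d ∧
      (∀ w, (Sum.inr w : Places L) ∈ psupp a ↔ 0 < d.1 w) ∧ (∀ v, (Sum.inl v : Places L) ∈ psupp a ↔ 0 < d.2 v) ∧
      (∀ w, (Sum.inr w : Places L) ∈ psupp b ↔ d.1 w < 0) ∧ (∀ v, (Sum.inl v : Places L) ∈ psupp b ↔ d.2 v < 0) := by
  classical
  refine ⟨(d.1.mapRange Int.toNat (by simp), fun v => ⟨max (d.2 v) 0, le_max_right _ _⟩),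
    ((-d.1).mapRange Int.toNat (by simp), fun v => ⟨max (-d.2 v) 0, le_max_right _ _⟩), ?_, ?_, ?_, ?_, ?_⟩
  · refine Prod.ext (Finsupp.ext fun w => ?_) (funext fun v => ?_)
    · simp only [Prod.fst_sub, Finsupp.coe_sub, Pi.sub_apply, toArithDivisor_fst, Finsupp.mapRange_apply,
        Finsupp.neg_apply]
      exact Int.toNat_sub_toNat_neg (d.1 w)
    · change max (d.2 v) 0 - max (-d.2 v) 0 = d.2 v
      rcases le_total (d.2 v) 0 with h | h
      · rw [max_eq_right h, max_eq_left (neg_nonneg.mpr h)]; ring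
      · rw [max_eq_left h, max_eq_right (neg_nonpos.mpr h)]; ring
  · intro w; simp [Finsupp.mapRange_apply, Int.toNat_eq_zero, not_le]
  · intro v
    rw [inl_mem_psupp]
    exact mk_max_ne_zero_iff (d.2 v)
  · intro w; simp [Finsupp.mapRange_apply, Int.toNat_eq_zero, not_le]
  · intro v
    rw [inl_mem_psupp]
    exact (mk_max_ne_zero_iff (-d.2 v)).trans neg_pos

/-- In `Φ(L)^gp`: `[a]/[b] = div(g)` (through the identification `gpEquiv`) when `a − b = div(g)` as arithmetic
divisors. [cite: MochizukiFrdI2008, Ex. 6.3 p.113] -/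
theorem of_div_of_eq_gpEquiv_symm (a b : EffArithDivisor L) (d : ArithDivisor L)
    (h : toArithDivisor L a - toArithDivisor L b = d) :
    Algebra.GrothendieckGroup.of (Multiplicative.ofAdd a) / Algebra.GrothendieckGroup.of (Multiplicative.ofAdd b) =
      (EffArithDivisor.gpEquiv L).symm (Multiplicative.ofAdd d) := by
  apply (EffArithDivisor.gpEquiv L).injective
  rw [MulEquiv.apply_symm_apply, map_div, EffArithDivisor.gpEquiv_apply, EffArithDivisor.gpEquiv_apply,
    EffArithDivisor.gpHom_of, EffArithDivisor.gpHom_of, toAdd_ofAdd, toAdd_ofAdd, ← ofAdd_sub, h]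

end EffArithDivisor

/-! ### Strict rationality of `C_{K/F}` -/

section Arith

open EffArithDivisor

variable (F : Type) [Field F] [NumberField F] (K : Type) [Field K] [Algebra F K]

/-- From the data row T64i/L08 ("it is immediate from the definition of `B`", FrdI p. 115 l. 37–38): at every
place `p` of a number field `L`, some `g ∈ L^× = B(L)` has `div(g)` POSITIVE at `p` — at a finite `w` an element
of positive order, at an archimedean `v` an element with `|g|_v ≠ 1`, inverted if necessary (the archimedean
coordinate of `div(g)` is `−log|g|_v`). [cite: MochizukiFrdI2008, Thm. 6.4 (i) p.115] -/
theorem arith_exists_rational_function_pos (h08 : Thm64i_L08_strictlyRational_data)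
    (L : Type) [Field L] [NumberField L] (p : Places L) :
    ∃ g : Lˣ, Sum.elim (fun v => 0 < (principalArithDivisor L g).2 v) (fun w => 0 < (principalArithDivisor L g).1 w) p := by
  obtain ⟨hfin, hinf⟩ := h08 L
  rcases p with v | w
  · obtain ⟨f, hf⟩ := hinf v
    rcases lt_or_gt_of_ne hf with hlt | hgt
    · exact ⟨f, by simpa using hlt⟩
    · refine ⟨f⁻¹, ?_⟩
      have : Real.log (v ((f⁻¹ : Lˣ) : L)) = -Real.log (v (f : L)) := by
        rw [Units.val_inv_eq_inv_val, map_inv₀, Real.log_inv]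
      simp only [Sum.elim_inl, principalArithDivisor_snd, this, neg_neg]
      exact hgt
  · obtain ⟨f, hf, -⟩ := hfin w
    exact ⟨f, by simpa using hf⟩

/-- **Theorem 6.4 (i), proof: "it is immediate from the definition of `B` that `C` is of [strictly] rational
type"** (FrdI p. 115 l. 37–38) — PROVED for THE constructed `C_{K/F}` at THE birationalization
(`PreFrobenioid.biratData`; `Φ^birat = Div_B(B)`, `ModelFrobenioidPhiBirat.lean`) and for ANY support predicate
obeying the support axiom `hSupp` (`𝔭 ∈ Supp(a)` iff some primary element of the class `𝔭` is `≼ a`), given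
abc-iut-L1-t1's data row T64i/L08: every object is strictly rational (Def. 4.5 (ii)) — for the prime of `Φ(L)` at
the place `p` take `g` with `div(g) > 0` at `p` and `a`, `b` the positive and negative parts of `div(g)`.
[cite: MochizukiFrdI2008, Thm. 6.4 (i) p.115] -/
theorem isStrictlyRational_arith (h08 : Thm64i_L08_strictlyRational_data)
    (hF : PreFrobenioid.IsFrobenioid
      (ModelFrobenioid.toElem (arithDivisorFunctor F K) (unitsFunctor F K) (divNatTrans F K)))
    (hsq : PreFrobenioid.HasBiratSquares
      (ModelFrobenioid.toElem (arithDivisorFunctor F K) (unitsFunctor F K) (divNatTrans F K)))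
    (Supp : ∀ {X : FinSubextCat F K}, (arithFrobenioidOps F K).Mon X → Primes ((arithFrobenioidOps F K).Mon X) → Prop)
    (hSupp : ∀ (X : FinSubextCat F K) (a : Multiplicative (EffArithDivisor X.L))
      (𝔭 : Primes (Multiplicative (EffArithDivisor X.L))),
      Supp a 𝔭 ↔ ∃ (a₀ : Multiplicative (EffArithDivisor X.L)) (h₀ : IsPrimary a₀),
        Quotient.mk (primarySetoid _) ⟨a₀, h₀⟩ = 𝔭 ∧ Precsim a₀ a)
    (A : arithFrobenioid F K) :
    PreFrobenioidData.IsStrictlyRational (PreFrobenioid.biratData hF hsq) Supp A := by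
  refine (ModelFrobenioid.isStrictlyRational_biratData_iff (unitsFunctor_isGroupLike F K)
    (arithDivisorFunctor_isDivisorial F K) hF hsq Supp A).mpr fun 𝔭 => ?_
  -- a primary representative of `𝔭`, supported at a single place `p`
  obtain ⟨⟨a₀, ha₀⟩, rfl⟩ := Quotient.exists_rep 𝔭
  let D₀ : EffArithDivisor A.base.L := Multiplicative.toAdd (α := EffArithDivisor A.base.L) a₀
  have ha₀' : IsPrimary (Multiplicative.ofAdd D₀) := ha₀
  obtain ⟨p, hp⟩ := isPrimary_iff.mp ha₀'
  -- a rational function with positive divisor at `p`, and the positive/negative parts of its divisor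
  obtain ⟨g, hg⟩ := arith_exists_rational_function_pos h08 A.base.L p
  obtain ⟨a, b, hab, ha_fin, ha_inf, hb_fin, hb_inf⟩ := exists_pos_neg (principalArithDivisor A.base.L g)
  have hpa : p ∈ psupp a := by
    rcases p with v | w
    · exact (ha_inf v).mpr hg
    · exact (ha_fin w).mpr hg
  have hpb : p ∉ psupp b := by
    rcases p with v | w
    · exact fun h => lt_asymm hg ((hb_inf v).mp h)
    · exact fun h => lt_asymm hg ((hb_fin w).mp h)
  refine ⟨Multiplicative.ofAdd a, Multiplicative.ofAdd b, ⟨g, ?_⟩, ?_, ?_⟩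
  · -- `[a]/[b] = Div_B(g)` in `Φ(L)^gp`
    exact of_div_of_eq_gpEquiv_symm a b _ hab
  · -- `𝔭 ∈ Supp(a)`: `a₀ ≼ a` since `supp a₀ = {p} ⊆ supp a`
    refine (hSupp A.base _ _).mpr ⟨Multiplicative.ofAdd D₀, ha₀', rfl, precsim_iff_psupp_subset.mpr ?_⟩
    rw [hp, Set.singleton_subset_iff]
    exact hpa
  · -- `𝔭 ∉ Supp(b)`: a primary `a₁ ~ a₀` with `a₁ ≼ b` would put `p` in `supp b`
    rintro hSb
    obtain ⟨a₁, ha₁, hrep, hprec⟩ := (hSupp A.base _ _).mp hSb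
    have h10 : Precsim a₁ (Multiplicative.ofAdd D₀) := Quotient.exact hrep
    have h01 : Precsim (Multiplicative.ofAdd D₀) a₁ := ha₀'.2 a₁ ha₁.1 h10
    have hsub := precsim_iff_psupp_subset.mp (h01.trans hprec)
    rw [hp, Set.singleton_subset_iff] at hsub
    exact hpb hsub

/-- Hence every object of `C_{K/F}` is RATIONAL (Def. 4.5 (ii)) w.r.t. THE birationalization and any such `Supp`.
[cite: MochizukiFrdI2008, Thm. 6.4 (i) p.115] -/
theorem isRational_arith (h08 : Thm64i_L08_strictlyRational_data)
    (hF : PreFrobenioid.IsFrobenioid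
      (ModelFrobenioid.toElem (arithDivisorFunctor F K) (unitsFunctor F K) (divNatTrans F K)))
    (hsq : PreFrobenioid.HasBiratSquares
      (ModelFrobenioid.toElem (arithDivisorFunctor F K) (unitsFunctor F K) (divNatTrans F K)))
    (Supp : ∀ {X : FinSubextCat F K}, (arithFrobenioidOps F K).Mon X → Primes ((arithFrobenioidOps F K).Mon X) → Prop)
    (hSupp : ∀ (X : FinSubextCat F K) (a : Multiplicative (EffArithDivisor X.L))
      (𝔭 : Primes (Multiplicative (EffArithDivisor X.L))),
      Supp a 𝔭 ↔ ∃ (a₀ : Multiplicative (EffArithDivisor X.L)) (h₀ : IsPrimary a₀),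
        Quotient.mk (primarySetoid _) ⟨a₀, h₀⟩ = 𝔭 ∧ Precsim a₀ a)
    (A : arithFrobenioid F K) :
    PreFrobenioidData.IsRational (PreFrobenioid.biratData hF hsq) Supp A :=
  ⟨A, 𝟙 A, PreFrobenioidData.isPullbackMorphism_id _ A, isStrictlyRational_arith F K h08 hF hsq Supp hSupp A⟩

end Arith

end Literature.AlgebraicGeometry.Frobenioids

end
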